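import Summits.PneNP.PneNP.Theorems.ConvexRankGatesLinAlgGateBlindRigidSpanProgram

/-!
# Route ConvexRankGates, crux `LinAlgGateBlind` (stmt-PneNP-10681): vertex-sum span programs satisfy SG

Corollary file of `Theorems/ConvexRankGatesLinAlgGateBlindRigidSpanProgram.lean` (`sg_of_rigidSpanProgram`:
pairwise-rigid span-program term gates satisfy the single-gate statement SG of the line
`dnf-invariant-wide-gates-see-small-cliques` with zero lost positives), for the research stub `stub_sgPerm` of
stmt-PneNP-10681.

The most natural parity-type candidates for an SG-violator (refuters' briefing
`Cruxes/LinAlgGateBlind/DrefuteG2SGSharpening.md` §2(c), §6) are XOR-SAT / linear-system term gates with the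
unknowns attached to the VERTICES: unknowns `z_v` (`v : Fin m`) over a division ring `F`, one equation
`Σ_{v ∈ X} z_v = b X` per clique atom `X ∈ 𝒱(l)`, arbitrary right-hand sides `b`; the gate accepts the graph `x`
iff the equations of the atoms present in `x` are inconsistent, i.e. (Fredholm alternative) iff
`(0, 1) ∈ span_F {(𝟙_X, b X) : X ∈ 𝒱(l), ⌈X⌉(x)}` — a monotone span program with rows `(𝟙_X, b X)`.

**Theorem (`sg_vertexSumSpanProgram`).** For `l ≥ 3` every such term gate admits a small-clique DNF `⌈𝒜⌉`,
`𝒜 ⊆ 𝒱(l)`, with `lostPos m k O 𝒜 = ∅` and `gainedNeg m q O 𝒜 ≤ Pr_{G(m,q)}[some vertex misses more than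
(m-3)/4 of its edges]` (exponentially small in the dense regime `q = 1 - 4 ln m / k`), WHATEVER `b`: these
designs are never violators. Proof: the span program is pairwise rigid on graphs of minimum degree
`≥ 3(m-1)/4 + O(1)` — through every vertex `v` two such graphs have a common triangle `{v,u,w}` with common
edge `{u,w}` (`exists_common_triangle`, counting), and `(𝟙_{vuw}, b) - (𝟙_{uw}, b') ≡ (e_v, 0)` modulo the
target `(0,1)`, so the rows of the commonly present atoms span every row modulo the target; then apply
`sg_of_rigidSpanProgram`. (Unknowns attached to PAIRS or larger sets give non-rigid programs — the direction of
a missing pair is seen only by broken atoms — and stay in the open part of `stub_sgPerm`.)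

No new definitions. [folklore]
-/

-- `Summit.PneNP.PneNP.…` duplicates `PneNP` BY DESIGN (single-problem summit).
set_option linter.dupNamespace false

namespace Summit.PneNP.PneNP.Theorems

open Finset Literature.Computability.Complexity Razborov
open Summit.PneNP.PneNP.Cruxes.LinAlgGateBlind.DnfInvariantWideGatesSeeSmallCliques

/-- Three pairwise present edges make a present triangle. [folklore] -/
theorem cliquePresent_triple {m : ℕ} {a b c : Fin m} {x : KEdge m → Bool}
    (hab : CliquePresent {a, b} x) (hac : CliquePresent {a, c} x) (hbc : CliquePresent {b, c} x) :
    CliquePresent {a, b, c} x := by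
  refine edge_ind fun u v huv => ?_
  intro hlive
  obtain ⟨hu, hv⟩ := (isLive_mk _).1 hlive
  simp only [mem_insert, mem_singleton] at hu hv
  rcases hu with rfl | rfl | rfl <;> rcases hv with rfl | rfl | rfl
  · exact absurd rfl huv
  · exact hab _ ((isLive_mk _).2 ⟨by simp, by simp⟩)
  · exact hac _ ((isLive_mk _).2 ⟨by simp, by simp⟩)
  · exact hab _ ((isLive_mk _).2 ⟨by simp, by simp⟩)
  · exact absurd rfl huv
  · exact hbc _ ((isLive_mk _).2 ⟨by simp, by simp⟩)
  · exact hac _ ((isLive_mk _).2 ⟨by simp, by simp⟩)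
  · exact hbc _ ((isLive_mk _).2 ⟨by simp, by simp⟩)
  · exact absurd rfl huv

open Classical in
/-- **Common triangles under a degree condition.** If in each of two graphs every vertex misses at most
`(m-3)/4` of its edges, then through every vertex `v` there are `u, w` with the triangle `{v,u,w}` and the edge
`{u,w}` present in BOTH graphs. [folklore] -/
theorem exists_common_triangle {m : ℕ} {G G' : KEdge m → Bool}
    (hG : ∀ v : Fin m, 4 * #(univ.filter fun u => u ≠ v ∧ ¬ CliquePresent ({v, u} : Finset (Fin m)) G) + 3 ≤ m)
    (hG' : ∀ v : Fin m, 4 * #(univ.filter fun u => u ≠ v ∧ ¬ CliquePresent ({v, u} : Finset (Fin m)) G') + 3 ≤ m)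
    (v : Fin m) :
    ∃ u w : Fin m, v ≠ u ∧ v ≠ w ∧ u ≠ w ∧
      CliquePresent {v, u, w} G ∧ CliquePresent {v, u, w} G' ∧
      CliquePresent {u, w} G ∧ CliquePresent {u, w} G' := by
  classical
  -- the common neighbourhood of `v` and the off-neighbourhoods cover all other vertices
  have hcard_ne : ∀ a : Fin m, #(univ.filter fun u : Fin m => u ≠ a) = m - 1 := fun a => by
    rw [filter_ne' univ a, card_erase_of_mem (mem_univ a), card_univ, Fintype.card_fin]
  set N : Finset (Fin m) := univ.filter fun u => u ≠ v ∧ CliquePresent ({v, u} : Finset (Fin m)) G ∧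
    CliquePresent ({v, u} : Finset (Fin m)) G' with hN
  have hcover : (univ.filter fun u : Fin m => u ≠ v) ⊆ N ∪
      ((univ.filter fun u => u ≠ v ∧ ¬ CliquePresent ({v, u} : Finset (Fin m)) G) ∪
        (univ.filter fun u => u ≠ v ∧ ¬ CliquePresent ({v, u} : Finset (Fin m)) G')) := by
    intro u hu
    simp only [mem_filter, mem_univ, true_and] at hu
    by_cases h1 : CliquePresent ({v, u} : Finset (Fin m)) G
    · by_cases h2 : CliquePresent ({v, u} : Finset (Fin m)) G'
      · exact mem_union_left _ (mem_filter.2 ⟨mem_univ _, hu, h1, h2⟩)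
      · exact mem_union_right _ (mem_union_right _ (mem_filter.2 ⟨mem_univ _, hu, h2⟩))
    · exact mem_union_right _ (mem_union_left _ (mem_filter.2 ⟨mem_univ _, hu, h1⟩))
  have hNcard : m - 1 ≤ #N +
      (#(univ.filter fun u => u ≠ v ∧ ¬ CliquePresent ({v, u} : Finset (Fin m)) G) +
        #(univ.filter fun u => u ≠ v ∧ ¬ CliquePresent ({v, u} : Finset (Fin m)) G')) := by
    calc m - 1 = #(univ.filter fun u : Fin m => u ≠ v) := (hcard_ne v).symm
      _ ≤ _ := card_le_card hcover
      _ ≤ _ := card_union_le _ _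
      _ ≤ _ := by gcongr; exact card_union_le _ _
  have hv1 := hG v
  have hv2 := hG' v
  -- `N` is nonempty
  have hNpos : 0 < #N := by omega
  obtain ⟨u, hu⟩ := card_pos.1 hNpos
  have hu' := hu
  simp only [hN, mem_filter, mem_univ, true_and] at hu'
  obtain ⟨huv, hvuG, hvuG'⟩ := hu'
  have hu1 := hG u
  have hu2 := hG' u
  -- a second common neighbour `w` of `v` adjacent to `u` in both graphs
  set Good : Finset (Fin m) := (N.erase u).filter fun w =>
    CliquePresent ({u, w} : Finset (Fin m)) G ∧ CliquePresent ({u, w} : Finset (Fin m)) G' with hGood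
  have hcover2 : N.erase u ⊆ Good ∪
      ((univ.filter fun w => w ≠ u ∧ ¬ CliquePresent ({u, w} : Finset (Fin m)) G) ∪
        (univ.filter fun w => w ≠ u ∧ ¬ CliquePresent ({u, w} : Finset (Fin m)) G')) := by
    intro w hw
    have hwu : w ≠ u := (mem_erase.1 hw).1
    by_cases h1 : CliquePresent ({u, w} : Finset (Fin m)) G
    · by_cases h2 : CliquePresent ({u, w} : Finset (Fin m)) G'
      · exact mem_union_left _ (mem_filter.2 ⟨hw, h1, h2⟩)
      · exact mem_union_right _ (mem_union_right _ (mem_filter.2 ⟨mem_univ _, hwu, h2⟩))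
    · exact mem_union_right _ (mem_union_left _ (mem_filter.2 ⟨mem_univ _, hwu, h1⟩))
  have hGoodcard : #N - 1 ≤ #Good +
      (#(univ.filter fun w => w ≠ u ∧ ¬ CliquePresent ({u, w} : Finset (Fin m)) G) +
        #(univ.filter fun w => w ≠ u ∧ ¬ CliquePresent ({u, w} : Finset (Fin m)) G')) := by
    calc #N - 1 = #(N.erase u) := (card_erase_of_mem hu).symm
      _ ≤ _ := card_le_card hcover2
      _ ≤ _ := card_union_le _ _
      _ ≤ _ := by gcongr; exact card_union_le _ _
  have hGoodpos : 0 < #Good := by omega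
  obtain ⟨w, hw⟩ := card_pos.1 hGoodpos
  simp only [hGood, mem_filter, mem_erase, hN, mem_univ, true_and] at hw
  obtain ⟨⟨hwu, hwv, hvwG, hvwG'⟩, huwG, huwG'⟩ := hw
  exact ⟨u, w, huv.symm, hwv.symm, hwu.symm, cliquePresent_triple hvuG hvwG huwG,
    cliquePresent_triple hvuG' hvwG' huwG', huwG, huwG'⟩

open Classical in
/-- **Vertex-sum span programs satisfy SG (corollary of `sg_of_rigidSpanProgram`; XOR-SAT-type term gates).**
Unknowns `z_v` on the VERTICES, one equation `Σ_{v ∈ X} z_v = b X` per atom `X ∈ 𝒱(l)` over any division ring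
`F`; the term gate accepts `x` iff the equations of the present atoms are inconsistent, i.e. (Fredholm) iff
`(0, 1) ∈ span {(𝟙_X, b X) : X ∈ 𝒱(l), ⌈X⌉(x)}`. For `l ≥ 3` this span program is pairwise rigid on graphs in
which every vertex misses at most `(m-3)/4` edges (a common triangle `{v,u,w}` minus the common edge `{u,w}` is
`(e_v, ·)`), so some `𝒜 ⊆ 𝒱(l)` has `lostPos = ∅` and `gainedNeg ≤ Pr_{G(m,q)}[some vertex misses more]` —
whatever the right-hand sides `b`. [folklore] -/
theorem sg_vertexSumSpanProgram :
    ∀ (m l k : ℕ) (q : ℝ), 0 ≤ q → q ≤ 1 → 3 ≤ l →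
    ∀ {F : Type} [DivisionRing F] (b : Finset (Fin m) → F) (O : (KEdge m → Bool) → Bool),
      (∀ x, O x = true ↔ ((0 : Fin m → F), (1 : F)) ∈ Submodule.span F
        ((fun X : Finset (Fin m) => ((fun v : Fin m => if v ∈ X then (1 : F) else 0), b X)) ''
          {X | X ∈ smallSets (Fin m) l ∧ CliquePresent X x})) →
      ∃ 𝒜 ⊆ smallSets (Fin m) l, lostPos m k O 𝒜 = ∅ ∧
        gainedNeg m q O 𝒜 ≤ prob q (fun G => ¬ ∀ v : Fin m,
          4 * #(univ.filter fun u => u ≠ v ∧ ¬ CliquePresent ({v, u} : Finset (Fin m)) G) + 3 ≤ m) := by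
  intro m l k q hq0 hq1 hl F _ b O hO
  classical
  set r : Finset (Fin m) → (Fin m → F) × F :=
    fun X => ((fun v : Fin m => if v ∈ X then (1 : F) else 0), b X) with hr
  set t : (Fin m → F) × F := ((0 : Fin m → F), (1 : F)) with ht
  refine sg_of_rigidSpanProgram m l k q hq0 hq1 r t O hO _ ?_
  intro G G' hG hG' X _
  set M : Submodule F ((Fin m → F) × F) := Submodule.span F
      (r '' {Y | Y ∈ smallSets (Fin m) l ∧ CliquePresent Y G ∧ CliquePresent Y G'}) ⊔ Submodule.span F {t}
    with hM
  have hrow : ∀ Y ∈ smallSets (Fin m) l, CliquePresent Y G → CliquePresent Y G' → r Y ∈ M :=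
    fun Y hY h1 h2 => Submodule.mem_sup_left (Submodule.subset_span ⟨Y, ⟨hY, h1, h2⟩, rfl⟩)
  have htM : t ∈ M := Submodule.mem_sup_right (Submodule.subset_span rfl)
  -- every coordinate vector `(e_v, 0)` lies in `M`
  have hsingle : ∀ v : Fin m, ((fun y : Fin m => if y = v then (1 : F) else 0), (0 : F)) ∈ M := by
    intro v
    obtain ⟨u, w, hvu, hvw, huw, h3, h3', h2, h2'⟩ := exists_common_triangle hG hG' v
    have hT : ({v, u, w} : Finset (Fin m)) ∈ smallSets (Fin m) l := by
      refine mem_smallSets.2 ⟨le_trans card_le_three hl, ?_⟩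
      have : 2 ≤ #({v, u, w} : Finset (Fin m)) := by
        calc 2 = #({v, u} : Finset (Fin m)) := (card_pair hvu).symm
          _ ≤ _ := card_le_card (by intro y hy; simp only [mem_insert, mem_singleton] at hy ⊢; tauto)
      omega
    have hE : ({u, w} : Finset (Fin m)) ∈ smallSets (Fin m) l :=
      mem_smallSets.2 ⟨by rw [card_pair huw]; omega, by rw [card_pair huw]; omega⟩
    have hmem : r {v, u, w} - r {u, w} - (b {v, u, w} - b {u, w}) • t ∈ M :=
      M.sub_mem (M.sub_mem (hrow _ hT h3 h3') (hrow _ hE h2 h2')) (M.smul_mem _ htM)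
    have heq : r {v, u, w} - r {u, w} - (b {v, u, w} - b {u, w}) • t =
        ((fun y : Fin m => if y = v then (1 : F) else 0), (0 : F)) := by
      refine Prod.ext ?_ ?_
      · funext y
        simp only [hr, ht, Prod.fst_sub, Prod.smul_fst, Pi.sub_apply, Pi.zero_apply,
          smul_zero, sub_zero, mem_insert, mem_singleton]
        by_cases hyv : y = v
        · subst hyv
          simp [hvu, hvw]
        · by_cases hyu : y = u
          · subst hyu; simp [hyv]
          · by_cases hyw : y = w
            · subst hyw; simp [hyv]
            · simp [hyv, hyu, hyw]
      · simp [hr, ht]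
    rw [heq] at hmem
    exact hmem
  -- hence every row lies in `M`
  have hdecomp : r X = ∑ v ∈ X, ((fun y : Fin m => if y = v then (1 : F) else 0), (0 : F)) + b X • t := by
    refine Prod.ext ?_ ?_
    · funext y
      simp only [hr, ht, Prod.fst_add, Prod.fst_sum, Prod.smul_fst, Pi.add_apply, Finset.sum_apply,
        Pi.zero_apply, smul_zero, add_zero]
      rw [Finset.sum_ite_eq]
    · simp [hr, ht, Prod.snd_sum]
  rw [hdecomp]
  exact M.add_mem (M.sum_mem fun v _ => hsingle v) (M.smul_mem _ htM)

end Summit.PneNP.PneNP.Theorems
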